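import Literature.NumberTheory.Sieve.MaynardNFBilinear
import Literature.NumberTheory.Sieve.MaynardEquidistribution
import Literature.NumberTheory.LFunctions.DedekindZetaVonMangoldt
import HarnessLib

/-!
# The Maynard–Tao sieve over `𝓞_K`: pushing the diagonal sums forward by the norm

Topic `Literature/NumberTheory/Sieve`. The main terms of Lemmas 2.2/2.3 of A. Castillo, C. Hall,
R. J. Lemke Oliver, P. Pollack, L. Thompson, *Bounded gaps between primes in number fields and
function fields*, Proc. AMS 143 (2015) = arXiv:1403.5808 (the sums
`∑_{𝔲₁,…,𝔲_k} (∏ᵢ μ²(𝔲ᵢ)1_{(𝔲ᵢ,𝔴)=1}/φ(𝔲ᵢ)) F(log N𝔲₁/log R, …)²`, evaluated in the paper by `k`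
applications of Lemma 2.5) depend on the ideals `𝔲ᵢ` only through their norms. Grouping the `𝔲ᵢ`
by norm turns them into the `ℕ`-indexed product-weight sums `MaynardTao.weightedSum` of the tree's
`MaynardEquidistribution.lean`, whose `k`-dimensional equidistribution theorem
(`MaynardTao.abs_weightedSum_sub_integral_le`) then applies verbatim, with the one-dimensional
counting functions supplied over `𝓞_K` (`IdealSieveSumsSharp.abs_sum_inv_totientIdeal_sub_sharp`).
Everything in this file is PROVED.

* `normWeight K 𝔴 n = ∑_{N𝔲 = n, 𝔲 squarefree, (𝔲,𝔴)=1} 1/φ(𝔲)` (and `normWeightG` with `g` in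
  place of `φ`), nonnegativity;
* `filter_G1_absNorm_eq` (the ideals of `G1 K 𝔴 R` of norm `n ≤ ⌊R⌋` are those of norm `n` that are
  squarefree and coprime to `𝔴`), **`sum_piFinset_G1_eq_weightedSum`**:
  `∑_{𝔲 ∈ G1^k} (∏ᵢ 1/φ(𝔲ᵢ)) H((log N𝔲ᵢ/log R)ᵢ) = weightedSum (normWeight K 𝔴) R H`;
* **`massUpTo_normWeight_eq`**: the counting function of `normWeight` is the sum
  `∑_{N𝔲 ≤ y, (𝔲,𝔴)=1, 𝔲 squarefree} 1/φ(𝔲)` of `IdealSieveSums` / `IdealSieveSumsSharp`.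

## References

* Castillo–Hall–Lemke Oliver–Pollack–Thompson, arXiv:1403.5808, §2.2 (proof of Proposition 2.1,
  via Lemmas 2.2–2.5). [CastilloEtAl2015]
* J. Maynard, *Small gaps between primes*, Ann. of Math. 181 (2015), proofs of Lemmas 6.2–6.3
  ((6.5)–(6.14)). [MaynardAnnals2015]
-/

noncomputable section

open Finset UniqueFactorizationMonoid NumberField
open scoped NumberField Classical

namespace Literature.NumberTheory.Sieve.MaynardNF

open Literature.NumberTheory.LFunctions Literature.NumberTheory.LFunctions.NumberField
  Literature.NumberTheory.Sieve.MaynardTao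

variable {K : Type*} [Field K] [NumberField K]
variable {k : ℕ}

/-! ### The norm-pushforward weights -/

variable (K) in
/-- `w_N(n) = ∑_{N𝔲 = n, 𝔲 squarefree, 𝔲 + 𝔴 = (1)} 1/φ(𝔲)` — the weight `μ²1_{(·,𝔴)=1}/φ` pushed
forward to `ℕ` by the norm. [cite: CastilloEtAl2015, §2.2 (the sums ∑ μ²(𝔲)/φ(𝔲))] -/
def normWeight (𝔴 : Ideal (𝓞 K)) (n : ℕ) : ℝ :=
  ∑ 𝔲 ∈ (idealsOfNorm K n).filter (fun 𝔲 => Squarefree 𝔲 ∧ 𝔲 ⊔ 𝔴 = ⊤), 1 / idealTotient K 𝔲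

/-- `w_N ≥ 0`. [folklore] -/
theorem normWeight_nonneg (𝔴 : Ideal (𝓞 K)) (n : ℕ) : 0 ≤ normWeight K 𝔴 n := by
  refine Finset.sum_nonneg fun 𝔲 hu => ?_
  have hsq := (Finset.mem_filter.1 hu).2.1
  exact (one_div_pos.2 (idealTotient_pos (fun h => hsq.ne_zero (h.trans Ideal.zero_eq_bot.symm)))).le

/-- The members of `G1 K 𝔴 R` of norm `n`, for `1 ≤ n ≤ ⌊R⌋`, are the ideals of norm `n` that are
squarefree and coprime to `𝔴`. [folklore] -/
theorem filter_G1_absNorm_eq (𝔴 : Ideal (𝓞 K)) (R : ℝ) {n : ℕ} (hn1 : 1 ≤ n) (hnR : n ≤ ⌊R⌋₊) :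
    (G1 K 𝔴 R).filter (fun 𝔲 => Ideal.absNorm 𝔲 = n) =
      (idealsOfNorm K n).filter (fun 𝔲 => Squarefree 𝔲 ∧ 𝔲 ⊔ 𝔴 = ⊤) := by
  ext 𝔲
  rw [Finset.mem_filter, mem_G1, Finset.mem_filter, mem_idealsOfNorm]
  constructor
  · rintro ⟨⟨-, hsq, hcop⟩, hN⟩
    exact ⟨hN, hsq, hcop⟩
  · rintro ⟨hN, hsq, hcop⟩
    refine ⟨⟨⟨?_, ?_⟩, hsq, hcop⟩, hN⟩
    · rw [Ne, ← Ideal.absNorm_eq_zero_iff, hN]; omega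
    · rw [hN]
      have hR0 : 0 ≤ R := by
        by_contra h
        rw [Nat.floor_of_nonpos (le_of_lt (not_le.1 h))] at hnR
        omega
      calc (n : ℝ) ≤ (⌊R⌋₊ : ℝ) := by exact_mod_cast hnR
        _ ≤ R := Nat.floor_le hR0

/-- The norm vector of a tuple of `G1` lies in the box `[1, ⌊R⌋]^k`. [folklore] -/
theorem absNorm_mem_maynardBox {𝔴 : Ideal (𝓞 K)} {R : ℝ} {𝔲 : Fin k → Ideal (𝓞 K)}
    (hu : 𝔲 ∈ Fintype.piFinset fun _ : Fin k => G1 K 𝔴 R) :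
    (fun i => Ideal.absNorm (𝔲 i)) ∈ maynardBox k R := by
  rw [mem_maynardBox_iff]
  intro i
  have h := mem_G1.1 (Fintype.mem_piFinset.1 hu i)
  refine ⟨Nat.one_le_iff_ne_zero.2 (by rw [Ne, Ideal.absNorm_eq_zero_iff]; exact h.1.1), ?_⟩
  exact Nat.le_floor h.1.2

/-- **Pushing the diagonal sum forward by the norm**:
`∑_{𝔲 ∈ G1^k} (∏ᵢ 1/φ(𝔲ᵢ)) H((log N𝔲ᵢ/log R)ᵢ) = weightedSum (fun _ => normWeight K 𝔴) R H`
(group the tuples `𝔲` by their norm vector `n ∈ [1,⌊R⌋]^k`; on a fibre `H` is constant and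
`∑_{fibre} ∏ᵢ 1/φ(𝔲ᵢ) = ∏ᵢ w_N(nᵢ)`). [cite: CastilloEtAl2015, §2.2 (proof of Proposition 2.1)] -/
theorem sum_piFinset_G1_eq_weightedSum (𝔴 : Ideal (𝓞 K)) (R : ℝ) (H : (Fin k → ℝ) → ℝ) :
    ∑ 𝔲 ∈ Fintype.piFinset (fun _ : Fin k => G1 K 𝔴 R),
        (∏ i, 1 / idealTotient K (𝔲 i)) *
          H (fun i => Real.log (Ideal.absNorm (𝔲 i)) / Real.log R) =
      weightedSum (fun _ => normWeight K 𝔴) R H := by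
  classical
  rw [weightedSum, ← Finset.sum_fiberwise_of_maps_to (s := Fintype.piFinset fun _ : Fin k => G1 K 𝔴 R)
    (t := maynardBox k R) (g := fun 𝔲 i => Ideal.absNorm (𝔲 i)) (fun 𝔲 hu => absNorm_mem_maynardBox hu)]
  refine Finset.sum_congr rfl fun n hn => ?_
  -- on the fibre over `n`, `H` is the constant `H (logPos R n)`
  have hconst : ∀ 𝔲 ∈ (Fintype.piFinset fun _ : Fin k => G1 K 𝔴 R).filter
      (fun 𝔲 => (fun i => Ideal.absNorm (𝔲 i)) = n),
      (∏ i, 1 / idealTotient K (𝔲 i)) * H (fun i => Real.log (Ideal.absNorm (𝔲 i)) / Real.log R) =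
        (∏ i, 1 / idealTotient K (𝔲 i)) * H (logPos R n) := by
    intro 𝔲 hu
    have hN : (fun i => Ideal.absNorm (𝔲 i)) = n := (Finset.mem_filter.1 hu).2
    congr 2
    funext i
    rw [logPos, ← hN]
  rw [Finset.sum_congr rfl hconst, ← Finset.sum_mul]
  congr 1
  -- the fibre is the product of the one-dimensional fibres
  have hfib : (Fintype.piFinset fun _ : Fin k => G1 K 𝔴 R).filter
      (fun 𝔲 => (fun i => Ideal.absNorm (𝔲 i)) = n) =
      Fintype.piFinset fun i => (G1 K 𝔴 R).filter (fun 𝔲 => Ideal.absNorm 𝔲 = n i) := by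
    ext 𝔲
    simp only [Finset.mem_filter, Fintype.mem_piFinset, funext_iff]
    exact ⟨fun ⟨h1, h2⟩ i => ⟨h1 i, h2 i⟩, fun h => ⟨fun i => (h i).1, fun i => (h i).2⟩⟩
  rw [hfib, ← Finset.prod_univ_sum (fun i => (G1 K 𝔴 R).filter (fun 𝔲 => Ideal.absNorm 𝔲 = n i))
    (fun _ 𝔲 => 1 / idealTotient K 𝔲)]
  refine Finset.prod_congr rfl fun i _ => ?_
  have hni := (mem_maynardBox_iff.1 hn) i
  rw [normWeight, filter_G1_absNorm_eq 𝔴 R hni.1 hni.2]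

/-! ### The counting function of `normWeight` -/

/-- Regrouping a norm-indexed double sum: `∑_{1 ≤ n ≤ ⌊y⌋} ∑_{N𝔲 = n, P 𝔲} g 𝔲 = ∑_{𝔲 ∈ idealsLE K y, P 𝔲} g 𝔲`.
[folklore] -/
theorem sum_Icc_sum_idealsOfNorm_filter_eq (P : Ideal (𝓞 K) → Prop) [DecidablePred P]
    (g : Ideal (𝓞 K) → ℝ) (y : ℝ) :
    ∑ n ∈ Finset.Icc 1 ⌊y⌋₊, ∑ 𝔲 ∈ (idealsOfNorm K n).filter (fun 𝔲 => P 𝔲), g 𝔲 =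
      ∑ 𝔲 ∈ (idealsLE K y).filter (fun 𝔲 => P 𝔲), g 𝔲 := by
  classical
  rw [← Finset.sum_fiberwise_of_maps_to (s := (idealsLE K y).filter (fun 𝔲 => P 𝔲))
    (t := Finset.Icc 1 ⌊y⌋₊) (g := fun 𝔞 => Ideal.absNorm 𝔞) (fun 𝔞 h𝔞 => ?_)]
  · refine Finset.sum_congr rfl fun n hn => Finset.sum_congr ?_ fun _ _ => rfl
    have hn1 : 1 ≤ n := (Finset.mem_Icc.1 hn).1
    ext 𝔞
    rw [Finset.mem_filter, mem_idealsOfNorm, Finset.mem_filter, Finset.mem_filter, mem_idealsLE]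
    constructor
    · rintro ⟨hN, hP⟩
      refine ⟨⟨⟨?_, ?_⟩, hP⟩, hN⟩
      · rw [Ne, ← Ideal.absNorm_eq_zero_iff, hN]; omega
      · rw [hN]
        have hy0 : 0 ≤ y := by
          by_contra h
          rw [Nat.floor_of_nonpos (le_of_lt (not_le.1 h))] at hn
          have := (Finset.mem_Icc.1 hn).2; omega
        calc (n : ℝ) ≤ (⌊y⌋₊ : ℝ) := by exact_mod_cast (Finset.mem_Icc.1 hn).2
          _ ≤ y := Nat.floor_le hy0
    · rintro ⟨⟨-, hP⟩, hN⟩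
      exact ⟨hN, hP⟩
  · rw [Finset.mem_filter, mem_idealsLE] at h𝔞
    exact Finset.mem_Icc.2 ⟨Nat.one_le_iff_ne_zero.2 (by rw [Ne, Ideal.absNorm_eq_zero_iff]; exact h𝔞.1.1),
      Nat.le_floor h𝔞.1.2⟩

/-- **The counting function of the pushforward weight** is the one-dimensional sieve sum over `𝓞_K`:
`massUpTo (normWeight K 𝔴) ⌊y⌋ = ∑_{0 < N𝔲 ≤ y, (𝔲,𝔴)=1, 𝔲 squarefree} ∏_{P∣𝔲} 1/(NP − 1)`
(`1/φ(𝔲) = ∏_{P∣𝔲} 1/(NP−1)` on squarefree `𝔲`, `idealTotient_of_squarefree`).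
[cite: CastilloEtAl2015, §2.2 (the sums ∑_{N𝔲<R,(𝔲,𝔴)=1} μ²(𝔲)/φ(𝔲))] -/
theorem massUpTo_normWeight_eq (𝔴 : Ideal (𝓞 K)) (y : ℝ) :
    massUpTo (normWeight K 𝔴) ⌊y⌋₊ =
      ∑ 𝔲 ∈ (idealsLE K y).filter (fun 𝔲 => 𝔲 ⊔ 𝔴 = ⊤ ∧ Squarefree 𝔲),
        ∏ P ∈ (normalizedFactors 𝔲).toFinset, 1 / ((Ideal.absNorm P : ℝ) - 1) := by
  classical
  rw [massUpTo]
  simp only [normWeight]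
  rw [sum_Icc_sum_idealsOfNorm_filter_eq (fun 𝔲 => Squarefree 𝔲 ∧ 𝔲 ⊔ 𝔴 = ⊤) (fun 𝔲 => 1 / idealTotient K 𝔲) y]
  have hset : (idealsLE K y).filter (fun 𝔲 => Squarefree 𝔲 ∧ 𝔲 ⊔ 𝔴 = ⊤) =
      (idealsLE K y).filter (fun 𝔲 => 𝔲 ⊔ 𝔴 = ⊤ ∧ Squarefree 𝔲) :=
    Finset.filter_congr fun _ _ => and_comm
  rw [hset]
  refine Finset.sum_congr rfl fun 𝔲 hu => ?_
  have hsq := (Finset.mem_filter.1 hu).2.2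
  rw [idealTotient_of_squarefree hsq, one_div, ← Finset.prod_inv_distrib]
  exact Finset.prod_congr rfl fun P _ => (one_div _).symm

end Literature.NumberTheory.Sieve.MaynardNF
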